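import Summits.Ventures.QEC.Census.HB.HB104.BZStructX
import Summits.Ventures.QEC.Census.HB.HB104.BZBoundsX
import Summits.Ventures.QEC.Census.HB.HB104.BZInfoSetsX1
import Summits.Ventures.QEC.Census.HB.HB104.BZEnumX01
import Summits.Ventures.QEC.Census.HB.HB104.BZEnumX02
import Summits.Ventures.QEC.Census.HB.HB104.BZEnumX03
import Summits.Ventures.QEC.Census.HB.HB104.BZEnumX04
import Summits.Ventures.QEC.Census.HB.HB104.BZEnumX05
import Summits.Ventures.QEC.Census.HB.HB104.BZEnumX06
import Summits.Ventures.QEC.Census.CertCheckBZSound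
import Summits.Ventures.QEC.Census.CertChunks
import HarnessLib

/-!
# `HB104` — `bz` certificate, side X: ASSEMBLY `d_X = 10` (tier KERNEL (CERTIFIED); emitted by qec-search-7)

`(cert.code _).dX = 10` for the CSS code of the certificate (`Fin 104`, check matrices `rowMatrix 104 cert.HX/HZ`) by
type-10's `DistCert.dX_code_of_bz` (`Census/CertCheckBZSound.lean`: structural check of the distance certificate +
`bzXStruct` + `bzXLen` + every block) with each block recombined from its KERNEL information-set facts
(`BZInfoSetsX*`), its enumeration verdicts (`BZEnumX*`) and its bound (`BZBoundsX`) by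
`CertBZInfoSets.bzXBlock_of_parts`.
-/

namespace Summit.Ventures.QEC.Census.HB104

/-- Block 0 of side X passes type-10's block check (from its parts). -/
theorem blkX_0 : HB104.cert.bzXBlock HB104.bzData 0 = true :=
  cert.bzXBlock_of_parts bzData (b := 0) (blk := bzBlockX0) rfl rfl
    (forall_lt_append (forall_lt_append (forall_lt_zero) (forall_lt_single 0 sysX_0_0)) (forall_lt_single 1 sysX_0_1))
    (forall_lt_append (forall_lt_append (forall_lt_zero) (forall_lt_single 0 enumX_0_0)) (forall_lt_single 1 enumX_0_1))
    boundX_0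

/-- Block 1 of side X passes type-10's block check (from its parts). -/
theorem blkX_1 : HB104.cert.bzXBlock HB104.bzData 1 = true :=
  cert.bzXBlock_of_parts bzData (b := 1) (blk := bzBlockX1) rfl rfl
    (forall_lt_append (forall_lt_append (forall_lt_zero) (forall_lt_single 0 sysX_1_0)) (forall_lt_single 1 sysX_1_1))
    (forall_lt_append (forall_lt_append (forall_lt_zero) (forall_lt_single 0 enumX_1_0)) (forall_lt_single 1 enumX_1_1))
    boundX_1

/-- Block 2 of side X passes type-10's block check (from its parts). -/
theorem blkX_2 : HB104.cert.bzXBlock HB104.bzData 2 = true :=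
  cert.bzXBlock_of_parts bzData (b := 2) (blk := bzBlockX2) rfl rfl
    (forall_lt_append (forall_lt_append (forall_lt_zero) (forall_lt_single 0 sysX_2_0)) (forall_lt_single 1 sysX_2_1))
    (forall_lt_append (forall_lt_append (forall_lt_zero) (forall_lt_single 0 enumX_2_0)) (forall_lt_single 1 enumX_2_1))
    boundX_2

set_option maxRecDepth 100000 in
/-- **`d_X = 10` for `HB104`** (tier KERNEL (CERTIFIED)): the CSS code of the certificate has X-distance exactly 10. -/
theorem dX_eq_bz : (HB104.cert.code (HB104.cert.commOK_of_checkStructure (by decide +kernel))).dX = 10 :=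
  HB104.cert.dX_code_of_bz HB104.bzData (by decide +kernel) bzXStruct_ok bzXLen_ok
    (forall_lt_append (forall_lt_append (forall_lt_append (forall_lt_zero) (forall_lt_single 0 blkX_0)) (forall_lt_single 1 blkX_1)) (forall_lt_single 2 blkX_2))

end Summit.Ventures.QEC.Census.HB104
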